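import Literature.Uncategorized.Crux
import Literature.Topology.FourManifolds.Rasmussen
import Literature.Topology.FourManifolds.RasmussenConcordanceProofs
import Literature.Topology.FourManifolds.KnotsIsotopyProofs

/-!
# `SVanishesOnPairs` fails iff a slice concordance-friend of a knot with `s ≠ 0` exists; `∀`- vs `∃`-form (negative lemmas for crux stmt-SmoothPoincare4-0368)

Crux `ZeroSurgeryExotic.ZseSVanishesOnPairs` (item `stmt-SmoothPoincare4-0368`) is, verbatim, the tree's
registered open statement `Literature.Uncategorized.SVanishesOnPairs`.  This file (standing disprover,
cdisprove gen 2) records the form in which the statement is currently ATTACKED IN PRINT and the status of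
its conclusion's quantifier:

* `not_sVanishesOnPairs_of_sliceConcordanceFriend` / `sVanishesOnPairs_iff_not_sliceConcordanceFriend` —
  modulo Rasmussen's concordance invariance of `s` (named fact `HasRasmussenInvariant.eq_of_isConcordant`,
  Rasmussen 2010 Thm 1; existence of a Rasmussen invariant is the DISCHARGED
  `Knot.exists_hasGaussDiagram_of_isIsotopic_holds`), the crux fails iff some smoothly SLICE knot `K` has a
  `0`-friend `K'` CONCORDANT to a knot `K₀` with `s(K₀) ≠ 0`.  This is exactly the success condition of
  Kegel–Spreer's Algorithm 6 (arXiv:2603.22438, March 2026, §6.3), whose live unresolved instances —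
  the 262-crossing `0`-friend `W₊''` of a knot concordant to `Wh⁺(T₂,₃)` (`s = 2`), and the `F4`/`F6`
  friends below the Conway knot's friends `K1, K2, K3` (`s ≠ 0`), none with a ribbon certificate after
  3·10⁴ band attachments — are the first live candidates against this crux in print since Dunfield–Gong
  2025 (whose 25 `(unknown, s ≠ 0)` pairs all certified NON-sliceness of `K` via super-special RBG
  presentations, DG Thm 5.9 / Table 10);
* `eq_zero_of_sVanishesOnPairs_of_isConcordant` — what a proof delivers on that pool (e.g. `W₊''` not slice);
* `hasRasmussenInvariant_unique`, `sVanishesOnPairs_iff_exists_form` — the `∀ s` conclusion of the crux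
  equals the `∃`-form "some Rasmussen invariant of `K'` is `0`" only modulo the two still-undischarged
  well-definedness facts `Knot.reidemeister` and `GaussDiagram.rasmussenInvariant_eq_of_equiv`.
No definitions (the pool predicate is spelled out); no route item is concluded positively.
-/

noncomputable section

set_option linter.dupNamespace false

open scoped Manifold ContDiff
open Literature.Topology.FourManifolds Literature.Uncategorized

namespace Summit.SmoothPoincare4.SmoothPoincare4.Theorems.ZseSVanishesOnPairs.Negative

/-- **A slice concordance-friend of a knot with `s ≠ 0` kills the crux** (given Rasmussen's concordance
invariance): if `K` is smoothly slice, `Y` is `0`-surgery on `K` and on `K'`, `K'` is concordant to `K₀`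
and `s(K₀) = s ≠ 0`, then `SVanishesOnPairs` fails — `K'` has SOME Rasmussen invariant
(`Knot.exists_hasGaussDiagram_of_isIsotopic_holds`), equal to `s` by concordance invariance, and the crux
would force it to vanish.  Live printed instances with the sliceness of `K` open: Kegel–Spreer 2026 §6.2(1)
(`K = W₊''`, `K' = W₊'`, `K₀ = Wh⁺(T₂,₃)`, `s = 2`) and §6.4 (`F4`, `F6` below `K1, K2, K3`).
[cite: KegelSpreer2026, §6.2–6.4 (arXiv:2603.22438)] [cite: Rasmussen2010, Thm. 1] -/
theorem not_sVanishesOnPairs_of_sliceConcordanceFriend (hC : HasRasmussenInvariant.eq_of_isConcordant)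
    (h : ∃ (K K' K₀ : Knot) (Y : Type) (_ : TopologicalSpace Y)
      (_ : ChartedSpace (EuclideanSpace ℝ (Fin 3)) Y) (s : ℤ),
      IsIntegralSurgery (𝓡 3) Y K 0 ∧ IsIntegralSurgery (𝓡 3) Y K' 0 ∧ K.IsSmoothlySlice ∧
        K'.IsConcordant K₀ ∧ K₀.HasRasmussenInvariant s ∧ s ≠ 0) :
    ¬ SVanishesOnPairs := by
  intro hc
  obtain ⟨K, K', K₀, Y, _, _, s, h1, h2, h3, h4, h5, h6⟩ := h
  obtain ⟨K'', D, hK'', hD⟩ := Knot.exists_hasGaussDiagram_of_isIsotopic_holds K'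
  have hK' : K'.HasRasmussenInvariant D.rasmussenInvariant := ⟨K'', D, hK'', hD, rfl⟩
  have h0 : D.rasmussenInvariant = 0 := hc K K' Y _ h1 h2 h3 hK'
  exact h6 ((hC hK' h5 h4).symm.trans h0)

/-- Conversely a counterexample to the crux IS a slice concordance-friend (`K₀ = K'`; concordance is
reflexive, `Knot.IsConcordant.refl'`, proved). [folklore] -/
theorem sliceConcordanceFriend_of_not_sVanishesOnPairs (h : ¬ SVanishesOnPairs) :
    ∃ (K K' K₀ : Knot) (Y : Type) (_ : TopologicalSpace Y)
      (_ : ChartedSpace (EuclideanSpace ℝ (Fin 3)) Y) (s : ℤ),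
      IsIntegralSurgery (𝓡 3) Y K 0 ∧ IsIntegralSurgery (𝓡 3) Y K' 0 ∧ K.IsSmoothlySlice ∧
        K'.IsConcordant K₀ ∧ K₀.HasRasmussenInvariant s ∧ s ≠ 0 := by
  obtain ⟨K, K', Y, _, _, s, h1, h2, h3, h4, h5⟩ := not_not.1 (mt not_crux_iff_sVanishesOnPairs.1 h)
  exact ⟨K, K', K', Y, _, _, s, h1, h2, h3, Knot.IsConcordant.refl' K', h4, h5⟩

/-- **The crux ⟺ no slice concordance-friend of a knot with `s ≠ 0`** (mod concordance invariance of `s`):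
the form attacked by Kegel–Spreer's Algorithm 6. [cite: KegelSpreer2026, §6.3 (arXiv:2603.22438)] -/
theorem sVanishesOnPairs_iff_not_sliceConcordanceFriend (hC : HasRasmussenInvariant.eq_of_isConcordant) :
    SVanishesOnPairs ↔ ¬ ∃ (K K' K₀ : Knot) (Y : Type) (_ : TopologicalSpace Y)
      (_ : ChartedSpace (EuclideanSpace ℝ (Fin 3)) Y) (s : ℤ),
      IsIntegralSurgery (𝓡 3) Y K 0 ∧ IsIntegralSurgery (𝓡 3) Y K' 0 ∧ K.IsSmoothlySlice ∧
        K'.IsConcordant K₀ ∧ K₀.HasRasmussenInvariant s ∧ s ≠ 0 :=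
  ⟨fun hc hf ↦ not_sVanishesOnPairs_of_sliceConcordanceFriend hC hf hc,
    fun hf ↦ not_not.1 fun hc ↦ hf (sliceConcordanceFriend_of_not_sVanishesOnPairs hc)⟩

/-- What a proof of the crux delivers on the candidate pool (given concordance invariance): a slice
`0`-friend `K` of `K'` forces `s(K₀) = 0` for every `K₀` concordant to `K'` — e.g. the crux implies that
Kegel–Spreer's `W₊''` is not slice (`s(Wh⁺(T₂,₃)) = 2`). [cite: KegelSpreer2026, §6.2 (arXiv:2603.22438)] -/
theorem eq_zero_of_sVanishesOnPairs_of_isConcordant (hC : HasRasmussenInvariant.eq_of_isConcordant)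
    (hc : SVanishesOnPairs) {K K' K₀ : Knot} {Y : Type} [TopologicalSpace Y]
    [ChartedSpace (EuclideanSpace ℝ (Fin 3)) Y] {s : ℤ}
    (h1 : IsIntegralSurgery (𝓡 3) Y K 0) (h2 : IsIntegralSurgery (𝓡 3) Y K' 0)
    (h3 : K.IsSmoothlySlice) (h4 : K'.IsConcordant K₀) (h5 : K₀.HasRasmussenInvariant s) : s = 0 := by
  by_contra h6
  exact not_sVanishesOnPairs_of_sliceConcordanceFriend hC
    ⟨K, K', K₀, Y, _, _, s, h1, h2, h3, h4, h5, h6⟩ hc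

/-- **`s(K)` is single-valued** modulo the two still-undischarged facts `Knot.reidemeister` and
`GaussDiagram.rasmussenInvariant_eq_of_equiv` (existence and the isotopy facts are proved).
[cite: Rasmussen2010, Thm. 1] -/
theorem hasRasmussenInvariant_unique (hR : Knot.reidemeister)
    (hinv : GaussDiagram.rasmussenInvariant_eq_of_equiv) {K : Knot} {s t : ℤ}
    (hs : K.HasRasmussenInvariant s) (ht : K.HasRasmussenInvariant t) : s = t :=
  (Knot.existsUnique_hasRasmussenInvariant Knot.exists_hasGaussDiagram_of_isIsotopic_holds hR hinv
    K).unique hs ht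

/-- **The `∀ s` conclusion of the crux (every Gauss diagram of every knot isotopic to `K'` has `s = 0`)
equals the `∃`-form "some Rasmussen invariant of `K'` is `0`" modulo uniqueness of `s`.**  A proof that
computes `s(K')` from one convenient diagram needs the two open facts; diagram-wise cobordism arguments
(Rasmussen, MMSW, Ren–Willis) do not. [cite: Rasmussen2010, Thm. 1] -/
theorem sVanishesOnPairs_iff_exists_form (hR : Knot.reidemeister)
    (hinv : GaussDiagram.rasmussenInvariant_eq_of_equiv) :
    SVanishesOnPairs ↔ ∀ (K K' : Knot) (Y : Type) [TopologicalSpace Y]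
      [ChartedSpace (EuclideanSpace ℝ (Fin 3)) Y],
      IsIntegralSurgery (𝓡 3) Y K 0 → IsIntegralSurgery (𝓡 3) Y K' 0 → K.IsSmoothlySlice →
        ∃ s, K'.HasRasmussenInvariant s ∧ s = 0 := by
  constructor
  · intro h K K' Y _ _ h1 h2 h3
    obtain ⟨K'', D, hK'', hD⟩ := Knot.exists_hasGaussDiagram_of_isIsotopic_holds K'
    exact ⟨D.rasmussenInvariant, ⟨K'', D, hK'', hD, rfl⟩, h K K' Y _ h1 h2 h3 ⟨K'', D, hK'', hD, rfl⟩⟩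
  · intro h K K' Y _ _ s h1 h2 h3 h4
    obtain ⟨s₀, hs₀, h0⟩ := h K K' Y h1 h2 h3
    exact (hasRasmussenInvariant_unique hR hinv h4 hs₀).trans h0

end Summit.SmoothPoincare4.SmoothPoincare4.Theorems.ZseSVanishesOnPairs.Negative
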